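import Mathlib
import HarnessLib
import Summits.Langlands.Langlands.Theorems.PolarisationCarvingBoxes

/-!
# PolarisationCarvingOrdinaryMates — the structural conjecture OCE «ordinary mates exist» (named def) and its domination kernels

Follow-up to the support module `Theorems/PolarisationCarvingBoxes.lean` (p777835, landed) for the lens-6-g13 child route `OrdinarySwitchCarving`
of route-Langlands-PolarisationCarving (GNS 33400), per crit-1 row 151: OCE is NOT implied by `Langlands` (reciprocity produces no ordinary
prime — the open Δ question), so it is a NAMED DEF here, not a route item; the child route's declared residual UNA (GNS-box ∧ ¬OX) is the
ghost it dominates.  Pure logic; 0 sorry; axioms standard.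
-/

set_option linter.dupNamespace false

noncomputable section

namespace Summit.Langlands.Langlands.Theorems.PolarisationCarvingBoxes

/-! ## Domination (g13): the structural conjecture OCE «ordinary mates exist» as a NAMED DEF (not a route item — it is not implied by
`Langlands`: reciprocity produces no ordinary prime, cf. the open Δ question) and the kernel facts that it EMPTIES the anordinary ghost
cell UNA of the child route `OrdinarySwitchCarving` and that GNS's box is exactly partitioned by the dial OX. -/

/-- OCE — ORDINARY MATES EXIST (structural, automorphy-free; open even for Δ-type systems): every member of the GNS box is
ordinary-switchable.  Named here so that the ghost item UNA of `OrdinarySwitchCarving` can cite its dominating conjecture by name. -/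
def OrdinaryMatesExist : Prop :=
  ∀ (K : Type) [Field K] [NumberField K] (n : ℕ), 2 ≤ n → ∀ (ℓ : ℕ) [Fact ℓ.Prime] (ρ : Literature.NumberTheory.GaloisRepresentations.FramedGaloisRep K (PadicAlgCl ℓ) n),
    ρ.toGaloisRep.IsIrreducible → IsPinnedGeometric ρ → ¬ HasSelfTwist ρ → InAnordinarySystemBox ρ → IsOrdinarySwitchable ρ

/-- Domination kernel: under OCE the anordinary ghost cell (GNS-box ∧ ¬OX) is EMPTY, so its automorphy statement (the child-route item
UNA `OrdinarySwitchCarving.UnswitchableAnordinaryAutomorphy`, which unfolds to this box form) holds vacuously. -/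
theorem unswitchableBox_automorphy_of_ordinaryMatesExist (h : OrdinaryMatesExist) :
    PrimitiveAutomorphyWhere fun K _ _ ℓ _ n ρ =>
      InAnordinarySystemBox (K := K) (ℓ := ℓ) (n := n) ρ ∧ ¬ IsOrdinarySwitchable (K := K) (ℓ := ℓ) (n := n) ρ := by
  intro K _ _ n hcpt hn ℓ _ ι ρ hirr hgeo htw hbox
  exact absurd (h K n hn ℓ ρ hirr hgeo htw hbox.1) hbox.2

/-- Exactness kernel: GNS (tree decl) ⟸ the two cells of the dial OX (switchable ∧ unswitchable), by excluded middle — the child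
route's items OSA / UNA unfold to these box forms. -/
theorem gns_of_switchable_of_unswitchable
    (hOSA : PrimitiveAutomorphyWhere fun K _ _ ℓ _ n ρ =>
      InAnordinarySystemBox (K := K) (ℓ := ℓ) (n := n) ρ ∧ IsOrdinarySwitchable (K := K) (ℓ := ℓ) (n := n) ρ)
    (hUNA : PrimitiveAutomorphyWhere fun K _ _ ℓ _ n ρ =>
      InAnordinarySystemBox (K := K) (ℓ := ℓ) (n := n) ρ ∧ ¬ IsOrdinarySwitchable (K := K) (ℓ := ℓ) (n := n) ρ) :
    Summit.Langlands.Langlands.Theses.PolarisationCarving.GappedNonOrdinarySystemAutomorphy := by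
  intro K _ _ n hcpt hn ℓ _ ι ρ hirr hgeo htw hbox
  rcases Classical.em (IsOrdinarySwitchable (K := K) (ℓ := ℓ) (n := n) ρ) with hx | hx
  · exact hOSA K n hcpt hn ℓ ι ρ hirr hgeo htw ⟨hbox, hx⟩
  · exact hUNA K n hcpt hn ℓ ι ρ hirr hgeo htw ⟨hbox, hx⟩

end Summit.Langlands.Langlands.Theorems.PolarisationCarvingBoxes

end
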